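import Summits.BirchSwinnertonDyer.BirchSwinnertonDyer.Theorems.CMKolyvaginAtInertTwoPairTelescopeBoundOfInjectiveKillAtTwo
import Summits.BirchSwinnertonDyer.BirchSwinnertonDyer.Theorems.CMKolyvaginAtInertTwoPairOfRatDataNegAtTwo
import Summits.BirchSwinnertonDyer.BirchSwinnertonDyer.Theorems.CMKolyvaginAtInertTwoPairHCTVOfMembersKillAtTwo
import Summits.BirchSwinnertonDyer.BirchSwinnertonDyer.Theorems.CMKolyvaginAtInertTwoPairTransportPairingAtTwo
import HarnessLib

/-!
# Route `CMKolyvaginAtInertTwo`, crux `CMKolyvaginExactAtInertTwo` (stmt-BirchSwinnertonDyer-24277):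
# THE PATH-(β) T2 ASSEMBLY IN THE ROOT-NUMBER BRANCH `w(E/ℚ) = +1` — McCallum's inequality
# `#Ш(E^{(d_K)})[2^L] · #Sel_{2^{2L}}(E) ≤ 2^{2M₀}` on the twin-first `ℚ`-pair carrier (KERNEL-STATUS §17.13, step S3)

Seat `bsd-line-cmk2-p1` g17 (cell `bsd-print-cf2`); helper (`--supports stmt-BirchSwinnertonDyer-24277`).
THEOREMS ONLY: no definition, no named fact, no `sorry`; no item is closed; BSD is not proved by this.

`…PairAssemblyOfPairDataAtTwo` (p717813) with the two members exchanged: two-member descent data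
`D : PairDataM (H¹(ℚ, E^{(d_K)}[2^{2L}])) (H¹(ℚ, E[2^{2L}])) Pl` (the twin holds `x`: Kolyvagin's class of `y_K` is
`τ`-anti-invariant when `w(E/ℚ) = +1`, Gross Prop. 5.4 (2) with `ε = −1`), split data `D.toSplitData.negSign`
(Literature `SplitDataM.negSign`: `ε = −1`, `eig (−1) = V₁ × 0`), pair map `f` into `PairV W σ₀ (2L) (−1) = V^{−} × V^{+}`
(`exists_pairOfRat_neg`), `heig`/`hA`/`hJε` from `…PairOfRatDataNegAtTwo`, the kill-clause telescope at `ε = −1`.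
The member formulas `hV₁` (twin, even depth) / `hV₂` (`E`, odd depth) have the shapes of `hV₂_canonical_of_par` /
`hV₁_canonical_of_par` at `(Par₁, Par₂) = (Odd, Even)` (`…PairMemberTwoParAtTwo` / `…PairMemberOneParAtTwo`).

* `card_mul_card_le_two_pow_two_mul_of_pairData_neg`.

References: [McCallumLMS1991] §5 Thm. 5.4 (proof), Cor. 5.6; [Kolyvagin1989Izv] §3; [GrossLMS1991] Prop. 5.4 (2).
-/

set_option linter.dupNamespace false
set_option autoImplicit false

noncomputable section

open scoped Classical
open scoped AddSubgroup
open WeierstrassCurve NumberField IsDedekindDomain Field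
open Literature.NumberTheory.GaloisRepresentations
open Literature.NumberTheory.EllipticCurves Literature.NumberTheory.EllipticCurves.KolyvaginDescent
open Summit.BirchSwinnertonDyer.BirchSwinnertonDyer.Theorems.GenusExact.EigenClassesFinite
open Summit.BirchSwinnertonDyer.BirchSwinnertonDyer.Theorems.GenusExact.VisiblePairAtTwo (twin lvl loc₁ loc₂ a₁ a₂ pl Dv kolPrime)

namespace Summit.BirchSwinnertonDyer.BirchSwinnertonDyer.Theorems.KolyvaginPairDataTwo

variable {N : ℕ} (W : WeierstrassCurve ℚ) {K : Type} [Field K] [NumberField K]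

set_option maxHeartbeats 1600000 in
/-- **McCallum's inequality `#Ш(E^{(d_K)}/ℚ)[2^L] · #Sel_{2^{2L}}(E/ℚ) ≤ 2^{2M₀}` in the root-number branch
`w(E/ℚ) = +1`** — the TWIN holds `x` (slot `V₁`, even depth), `E` carries the odd depths; split data
`D.toSplitData.negSign` (`ε = −1`), pair map into `PairV … (−1)` with `(f v).1 = ψ (res v.1)`, `(f v).2 = res v.2`;
p717813's proof with the two factors exchanged (telescope at `ε = −1`). [cite: McCallumLMS1991, §5 Thm. 5.4 (proof, p. 307), Cor. 5.6]
[cite: Kolyvagin1989Izv, §3] [cite: GrossLMS1991, Prop. 5.4 (2)] -/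
theorem card_mul_card_le_two_pow_two_mul_of_pairData_neg
    (hC : Literature.NumberTheory.Automorphic.chebotarev_artinRep)
    [NeZero N] [W.IsElliptic] (hK : IsImaginaryQuadratic K) (hρ : W.HasSurjectiveModNGaloisRep 2)
    (hΔ : W.Δ < 0) (hΔK : ¬ IsSquare (W.baseChange K).Δ)
    (h2 : Module.finrank ℚ K = 2) {θ : K} (hθ : θ ∉ Set.range (algebraMap ℚ K))
    (hd : θ ^ 2 = algebraMap ℚ K ((NumberField.discr K : ℤ) : ℚ)) {L : ℕ}
    {c₀ : absoluteGaloisGroup ℚ} (hc₀ : IsComplexConjugation (Rat.castHom ℝ) c₀)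
    {z : absoluteGaloisGroup K}
    (hzfix : ∀ P : geomTorsion (W.baseChange K) ((2 : ℕ) : ℤ), z • P = P → P = 0)
    (hcomm : ∀ π ∈ torsionFixing (W.baseChange K) ((2 : ℕ) : ℤ),
      ∀ P : geomTorsion (W.baseChange K) ((2 ^ (L + L + 1) : ℕ) : ℤ), π • z • P = z • π • P)
    {S : ℕ → Prop}
    (hS : ∀ ℓ, IsKolyvaginPrime N W K 2 ℓ → FrobEqFrobInfty W K (2 ^ (L + L + 1)) ℓ → S ℓ)
    {P₀ : (W.baseChange K).toAffine.Point} (hP₀ : IsHeegnerPoint N W K P₀)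
    (hnoTors : ∀ P : (W.baseChange K).toAffine.Point, ((2 ^ (L + L) : ℕ) : ℤ) • P = 0 → P = 0)
    -- the two-member descent data on the `ℚ`-pair carrier
    (D : PairDataM (galH1Torsion (twin W K) (lvl (L + L))) (galH1Torsion W (lvl (L + L)))
      (HeightOneSpectrum (𝓞 ℚ) ⊕ InfinitePlace ℚ))
    (hDp : D.p = 2) (hDM : D.M = L + L)
    (hDSel₁ : D.Sel₁ = selmerGroup (twin W K) (lvl (L + L)))
    (hDSel₂ : D.Sel₂ = selmerGroup W (lvl (L + L)))
    (hDA₁ : D.A₁ = a₂ W K (L + L)) (hDA₂ : D.A₂ = a₁ W (L + L))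
    (hDKol : ∀ ℓ, D.Kol ℓ ↔ IsKolyvaginPrime N W K 2 ℓ ∧ FrobEqFrobInfty W K (2 ^ (L + L + 1)) ℓ ∧ S ℓ)
    (hM₀L : D.M₀ ≤ L)
    -- the map into the eigen-pair and the local compatibility at Kolyvagin primes
    (f : galH1Torsion (twin W K) (lvl (L + L)) × galH1Torsion W (lvl (L + L)) →+
      PairV W (sigmaQ K h2 hθ hd) (L + L) (-1))
    (hf : Function.Injective f)
    (hf₁ : ∀ v, ((f v).1 : galH1Torsion (W.baseChange K) ((2 ^ (L + L) : ℕ) : ℤ)) =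
      hPsiKT W K hθ hd (lvl (L + L)) (resTorsion (twin W K) K (lvl (L + L)) v.1))
    (hf₂ : ∀ v, ((f v).2 : galH1Torsion (W.baseChange K) ((2 ^ (L + L) : ℕ) : ℤ)) =
      resTorsion W K (lvl (L + L)) v.2)
    (hA : ∀ ℓ, D.Kol ℓ → ∀ v, v ∈ D.toSplitData.negSign.negSign.A ℓ ↔ f v ∈ pairA (N := N) W (sigmaQ K h2 hθ hd) (L + L) (-1) ℓ)
    -- the Cassels–Tate member formulas (shape of `hV₁/hV₂_canonical_of_kol`, `Kol := D.Kol`, `M₀ := D.M₀`)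
    (B₁ : ((twin W K).sha)[(2 ^ L : ℕ)] →+ ((twin W K).sha)[(2 ^ L : ℕ)] →+ AddCircle (1 : ℚ))
    (ι₁ : selmerGroup (twin W K) (lvl (L + L)) →+ ((twin W K).sha)[(2 ^ L : ℕ)])
    (hV₁ : ∀ ℓ m' : ℕ, D.Kol ℓ → KolSupp D.Kol (ℓ * m') → ¬ ℓ ∣ m' → Odd m'.primeFactors.card →
      ∀ (j N' a b : ℕ) (t : galH1Torsion (twin W K) (lvl (L + L))) (ht : t ∈ selmerGroup (twin W K) (lvl (L + L)))
        (hz : ((2 : ℤ) ^ j) • D.c₁ (ℓ * m') ∈ selmerGroup (twin W K) (lvl (L + L))),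
      ((2 : ℤ) ^ N') • t = 0 → ((2 : ℤ) ^ L) • t = 0 →
      (∀ q ∈ m'.primeFactors, t ∈ a₂ W K (L + L) q) → L + L - D.M₀ ≤ j →
      N' + D.M₀ ≤ L + L → N' ≤ j → a + b + 1 = N' →
      ((2 : ℤ) ^ (a + (j - N'))) • D.c₂ m' ∉ a₁ W (L + L) ℓ →
      ((2 : ℤ) ^ b) • t ∉ a₂ W K (L + L) ℓ →
      (B₁.comp ι₁).compl₂ ι₁ ⟨_, hz⟩ ⟨t, ht⟩ ≠ 0)
    (B₂ : (W.sha)[(2 ^ L : ℕ)] →+ (W.sha)[(2 ^ L : ℕ)] →+ AddCircle (1 : ℚ))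
    (ι₂ : selmerGroup W (lvl (L + L)) →+ (W.sha)[(2 ^ L : ℕ)])
    (hV₂ : ∀ ℓ m' : ℕ, D.Kol ℓ → KolSupp D.Kol (ℓ * m') → ¬ ℓ ∣ m' → Even m'.primeFactors.card →
      ∀ (j N' a b : ℕ) (t : galH1Torsion W (lvl (L + L)))
        (ht : t ∈ selmerGroup W (lvl (L + L)))
        (hz : ((2 : ℤ) ^ j) • D.c₂ (ℓ * m') ∈ selmerGroup W (lvl (L + L))),
      ((2 : ℤ) ^ N') • t = 0 → ((2 : ℤ) ^ L) • t = 0 →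
      (∀ q ∈ m'.primeFactors, t ∈ a₁ W (L + L) q) → L + L - D.M₀ ≤ j →
      N' + D.M₀ ≤ L + L → N' ≤ j → a + b + 1 = N' →
      ((2 : ℤ) ^ (a + (j - N'))) • D.c₁ m' ∉ a₂ W K (L + L) ℓ →
      ((2 : ℤ) ^ b) • t ∉ a₁ W (L + L) ℓ →
      (B₂.comp ι₂).compl₂ ι₂ ⟨_, hz⟩ ⟨t, ht⟩ ≠ 0)
    -- the abstract `ℚ`-side (rank one / rank zero, finiteness, Cassels–Tate nondegeneracy)
    [Finite (selmerGroup (twin W K) (lvl (L + L)))] [Finite (selmerGroup W (lvl (L + L)))]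
    (hι₁ : Function.Surjective ι₁) (x₁ : selmerGroup (twin W K) (lvl (L + L)))
    (hx₁ : (x₁ : galH1Torsion (twin W K) (lvl (L + L))) = D.x)
    (hker : ι₁.ker = AddSubgroup.zmultiples x₁)
    (hxord : addOrderOf x₁ = AddMonoid.exponent (selmerGroup (twin W K) (lvl (L + L))))
    (hB₁alt : ∀ a, B₁ a a = 0) (hB₁nd : ∀ a, (∀ b, B₁ a b = 0) → a = 0)
    (hB₂alt : ∀ v : selmerGroup W (lvl (L + L)), B₂ (ι₂ v) (ι₂ v) = 0)
    (hB₂nd : ∀ v : selmerGroup W (lvl (L + L)), (∀ w, B₂ (ι₂ v) (ι₂ w) = 0) → v = 0)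
    (hkill₂ : ∀ v : selmerGroup W (lvl (L + L)), 2 ^ L • v = 0) :
    Nat.card (((twin W K).sha)[(2 ^ L : ℕ)]) * Nat.card (selmerGroup W (lvl (L + L))) ≤ 2 ^ (2 * D.M₀) := by
  -- ### abbreviations
  -- the injections `J₁ = (·, 0)`, `J₂ = (0, ·)` into the carrier
  set J₁ : (selmerGroup (twin W K) (lvl (L + L))) →+ galH1Torsion (twin W K) (lvl (L + L)) × galH1Torsion W (lvl (L + L)) :=
    (AddMonoidHom.inl _ _).comp (selmerGroup (twin W K) (lvl (L + L))).subtype with hJ₁def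
  set J₂ : (selmerGroup W (lvl (L + L))) →+ galH1Torsion (twin W K) (lvl (L + L)) × galH1Torsion W (lvl (L + L)) :=
    (AddMonoidHom.inr _ _).comp (selmerGroup W (lvl (L + L))).subtype with hJ₂def
  have hJ₁a : ∀ t : (selmerGroup (twin W K) (lvl (L + L))), J₁ t = ((t : galH1Torsion (twin W K) (lvl (L + L))), 0) := fun _ ↦ rfl
  have hJ₂a : ∀ t : (selmerGroup W (lvl (L + L))), J₂ t = (0, (t : galH1Torsion W (lvl (L + L)))) := fun _ ↦ rfl
  have hJ₁ : Function.Injective J₁ := by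
    intro a b h
    have h1 := congrArg Prod.fst h
    rw [hJ₁a, hJ₁a] at h1
    exact Subtype.ext h1
  have hJ₂ : Function.Injective J₂ := by
    intro a b h
    have h1 := congrArg Prod.snd h
    rw [hJ₂a, hJ₂a] at h1
    exact Subtype.ext h1
  have hJsum : ∀ (t₁ : (selmerGroup (twin W K) (lvl (L + L)))) (t₂ : (selmerGroup W (lvl (L + L)))), J₁ t₁ + J₂ t₂ =
      ((t₁ : galH1Torsion (twin W K) (lvl (L + L))), (t₂ : galH1Torsion W (lvl (L + L)))) := by
    intro t₁ t₂
    rw [hJ₁a, hJ₂a, Prod.mk_add_mk, add_zero, zero_add]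
  -- ### unfoldings of `Sd := D.toSplitData`
  have hpZ : ((D.toSplitData.negSign.p : ℕ) : ℤ) = 2 := by rw [SplitDataM.negSign_p, PairDataM.toSplitData_p, hDp, Nat.cast_ofNat]
  have hp : D.toSplitData.negSign.p = 2 := by rw [SplitDataM.negSign_p, PairDataM.toSplitData_p, hDp]
  have hM : D.toSplitData.negSign.M = L + L := by rw [SplitDataM.negSign_M, PairDataM.toSplitData_M, hDM]
  have hSdcE : ∀ n, Even n.primeFactors.card → D.toSplitData.negSign.c n = (D.c₁ n, 0) :=
    fun n h ↦ (toSplitData_negSign_c D n).trans (D.pairClass_of_even h)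
  have hSdcO : ∀ n, Odd n.primeFactors.card → D.toSplitData.negSign.c n = (0, D.c₂ n) :=
    fun n h ↦ (toSplitData_negSign_c D n).trans (D.pairClass_of_odd h)
  have hSelmem : ∀ v, v ∈ D.toSplitData.negSign.Sel ↔ v.1 ∈ (selmerGroup (twin W K) (lvl (L + L))) ∧ v.2 ∈ (selmerGroup W (lvl (L + L))) := by
    intro v
    rw [mem_toSplitData_negSign_sel_iff, hDSel₁, hDSel₂]
  have hAmem : ∀ ℓ v, v ∈ D.toSplitData.negSign.A ℓ ↔ v.1 ∈ a₂ W K (L + L) ℓ ∧ v.2 ∈ a₁ W (L + L) ℓ := by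
    intro ℓ v
    rw [mem_toSplitData_negSign_A_iff, hDA₁, hDA₂]
  have hSel : ∀ (u : (selmerGroup (twin W K) (lvl (L + L)))) (v : (selmerGroup W (lvl (L + L)))), J₁ u + J₂ v ∈ D.toSplitData.negSign.Sel := by
    intro u v
    rw [hJsum, hSelmem]
    exact ⟨u.2, v.2⟩
  have hSelJ : ∀ s ∈ D.toSplitData.negSign.Sel, ∃ (t₁ : (selmerGroup (twin W K) (lvl (L + L)))) (t₂ : (selmerGroup W (lvl (L + L)))), s = J₁ t₁ + J₂ t₂ := by
    intro s hs
    obtain ⟨h1, h2'⟩ := (hSelmem s).mp hs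
    exact ⟨⟨s.1, h1⟩, ⟨s.2, h2'⟩, by rw [hJsum]⟩
  have hpure₁ : ∀ (t₁ : (selmerGroup (twin W K) (lvl (L + L)))) (t₂ : (selmerGroup W (lvl (L + L)))), J₁ t₁ + J₂ t₂ ∈ D.toSplitData.negSign.eig D.toSplitData.negSign.ε → J₂ t₂ = 0 := by
    intro t₁ t₂ h
    rw [PairDataM.toSplitData_negSign_ε, hJsum, PairDataM.mem_toSplitData_negSign_eig_neg_one_iff] at h
    have h' : (t₂ : galH1Torsion W (lvl (L + L))) = 0 := h
    rw [hJ₂a, h', Prod.mk_zero_zero]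
  have hpure₂ : ∀ (t₁ : (selmerGroup (twin W K) (lvl (L + L)))) (t₂ : (selmerGroup W (lvl (L + L)))), J₁ t₁ + J₂ t₂ ∈ D.toSplitData.negSign.eig (-D.toSplitData.negSign.ε) → J₁ t₁ = 0 := by
    intro t₁ t₂ h
    rw [PairDataM.toSplitData_negSign_ε, neg_neg, hJsum, PairDataM.mem_toSplitData_negSign_eig_one_iff] at h
    have h' : (t₁ : galH1Torsion (twin W K) (lvl (L + L))) = 0 := h
    rw [hJ₁a, h', Prod.mk_zero_zero]
  -- ### the transported pairing `P = B₁∘(ι₁×ι₁) ⊕ B₂∘(ι₂×ι₂)` on `Sd.Sel`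
  set Q₁ : (selmerGroup (twin W K) (lvl (L + L))) →+ (selmerGroup (twin W K) (lvl (L + L))) →+ AddCircle (1 : ℚ) := (B₁.comp ι₁).compl₂ ι₁ with hQ₁
  set Q₂ : (selmerGroup W (lvl (L + L))) →+ (selmerGroup W (lvl (L + L))) →+ AddCircle (1 : ℚ) := (B₂.comp ι₂).compl₂ ι₂ with hQ₂
  have hι₁inj : Function.Injective (selmerGroup (twin W K) (lvl (L + L))).subtype := fun a b h ↦ Subtype.ext h
  have hι₂inj : Function.Injective (selmerGroup W (lvl (L + L))).subtype := fun a b h ↦ Subtype.ext h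
  have hSelT : ∀ s ∈ D.toSplitData.negSign.Sel, s.1 ∈ (selmerGroup (twin W K) (lvl (L + L))).subtype.range ∧ s.2 ∈ (selmerGroup W (lvl (L + L))).subtype.range := by
    intro s hs
    rw [AddSubgroup.range_subtype, AddSubgroup.range_subtype]
    exact (hSelmem s).mp hs
  set P : D.toSplitData.negSign.Sel →+ D.toSplitData.negSign.Sel →+ AddCircle (1 : ℚ) :=
    transportPairing hι₁inj hι₂inj hSelT Q₁ Q₂ with hPdef
  have hPapply : ∀ (t₁ t₁' : (selmerGroup (twin W K) (lvl (L + L)))) (t₂ t₂' : (selmerGroup W (lvl (L + L)))) (h : J₁ t₁ + J₂ t₂ ∈ D.toSplitData.negSign.Sel)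
      (h' : J₁ t₁' + J₂ t₂' ∈ D.toSplitData.negSign.Sel),
      P ⟨J₁ t₁ + J₂ t₂, h⟩ ⟨J₁ t₁' + J₂ t₂', h'⟩ = Q₁ t₁ t₁' + Q₂ t₂ t₂' := by
    intro t₁ t₁' t₂ t₂' h h'
    have hm : (((t₁ : galH1Torsion (twin W K) (lvl (L + L))), (t₂ : galH1Torsion W (lvl (L + L)))) :
        galH1Torsion (twin W K) (lvl (L + L)) × galH1Torsion W (lvl (L + L))) ∈ D.toSplitData.negSign.Sel := by
      rw [← hJsum]; exact h
    have hm' : (((t₁' : galH1Torsion (twin W K) (lvl (L + L))), (t₂' : galH1Torsion W (lvl (L + L)))) :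
        galH1Torsion (twin W K) (lvl (L + L)) × galH1Torsion W (lvl (L + L))) ∈ D.toSplitData.negSign.Sel := by
      rw [← hJsum]; exact h'
    have e1 : (⟨J₁ t₁ + J₂ t₂, h⟩ : D.toSplitData.negSign.Sel) = ⟨((selmerGroup (twin W K) (lvl (L + L))).subtype t₁, (selmerGroup W (lvl (L + L))).subtype t₂), hm⟩ :=
      Subtype.ext (hJsum t₁ t₂)
    have e2 : (⟨J₁ t₁' + J₂ t₂', h'⟩ : D.toSplitData.negSign.Sel) = ⟨((selmerGroup (twin W K) (lvl (L + L))).subtype t₁', (selmerGroup W (lvl (L + L))).subtype t₂'), hm'⟩ :=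
      Subtype.ext (hJsum t₁' t₂')
    rw [e1, e2, hPdef, transportPairing_apply]
  -- ### the member formulas in `Sd`-currency
  have hV₁' : ∀ ℓ m : ℕ, D.toSplitData.negSign.Kol ℓ → KolSupp D.toSplitData.negSign.Kol (ℓ * m) → ¬ ℓ ∣ m →
      Even (ℓ * m).primeFactors.card →
      ∀ (j N' a b : ℕ) (t₁ z₁ : (selmerGroup (twin W K) (lvl (L + L)))), J₁ t₁ ∈ D.toSplitData.negSign.Sel →
      ((D.toSplitData.negSign.p : ℤ) ^ j) • D.toSplitData.negSign.c (ℓ * m) = J₁ z₁ →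
      J₁ z₁ ∈ D.toSplitData.negSign.Sel → ((D.toSplitData.negSign.p : ℤ) ^ L) • J₁ t₁ = 0 →
      ((D.toSplitData.negSign.p : ℤ) ^ N') • J₁ t₁ = 0 →
      (∀ q ∈ m.primeFactors, J₁ t₁ ∈ D.toSplitData.negSign.A q) →
      D.toSplitData.negSign.M - D.toSplitData.negSign.M₀ ≤ j → N' + D.toSplitData.negSign.M₀ ≤ D.toSplitData.negSign.M → N' ≤ j →
      a + b + 1 = N' →
      ((D.toSplitData.negSign.p : ℤ) ^ (a + (j - N'))) • D.toSplitData.negSign.c m ∉ D.toSplitData.negSign.A ℓ →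
      ((D.toSplitData.negSign.p : ℤ) ^ b) • J₁ t₁ ∉ D.toSplitData.negSign.A ℓ →
      Q₁ z₁ t₁ ≠ 0 := by
    intro ℓ m hℓ hsupp hndvd hev j N' a b t₁ z₁ _ hzeq _ hk hN hAq hj hNM hNj hab hcm hbt
    have hℓK : D.Kol ℓ := hℓ
    have hsuppK : KolSupp D.Kol (ℓ * m) := hsupp
    obtain ⟨-, hcard⟩ := D.kolSupp_of_mul hℓK hsuppK
    have hodd : Odd m.primeFactors.card := by
      rcases Nat.even_or_odd m.primeFactors.card with h | h
      · exfalso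
        rw [← hcard] at hev
        exact (Nat.not_even_iff_odd.mpr h.add_one) hev
      · exact h
    rw [hpZ] at hzeq hk hN hcm hbt
    rw [hSdcE _ hev, hJ₁a, Prod.smul_mk, zsmul_zero] at hzeq
    have hz1 : ((2 : ℤ) ^ j) • D.c₁ (ℓ * m) = (z₁ : galH1Torsion (twin W K) (lvl (L + L))) :=
      congrArg Prod.fst hzeq
    have hz : ((2 : ℤ) ^ j) • D.c₁ (ℓ * m) ∈ selmerGroup (twin W K) (lvl (L + L)) := by rw [hz1]; exact z₁.2
    rw [hJ₁a, Prod.smul_mk, zsmul_zero, Prod.mk_eq_zero] at hk hN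
    have hAq' : ∀ q ∈ m.primeFactors, (t₁ : galH1Torsion (twin W K) (lvl (L + L))) ∈ a₂ W K (L + L) q :=
      fun q hq ↦ ((hAmem q _).mp (hAq q hq)).1
    rw [hM] at hj hNM
    have hcm' : ((2 : ℤ) ^ (a + (j - N'))) • D.c₂ m ∉ a₁ W (L + L) ℓ := by
      intro hmem
      apply hcm
      rw [hSdcO _ hodd, Prod.smul_mk, zsmul_zero, hAmem]
      exact ⟨zero_mem _, hmem⟩
    have hbt' : ((2 : ℤ) ^ b) • (t₁ : galH1Torsion (twin W K) (lvl (L + L))) ∉ a₂ W K (L + L) ℓ := by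
      intro hmem
      apply hbt
      rw [hJ₁a, Prod.smul_mk, zsmul_zero, hAmem]
      exact ⟨hmem, zero_mem _⟩
    have key := hV₁ ℓ m hℓK hsuppK hndvd hodd j N' a b (t₁ : galH1Torsion (twin W K) (lvl (L + L))) t₁.2 hz
      hN.1 hk.1 hAq' hj hNM hNj hab hcm' hbt'
    have e1 : (⟨((2 : ℤ) ^ j) • D.c₁ (ℓ * m), hz⟩ : ↥(selmerGroup (twin W K) (lvl (L + L)))) = z₁ :=
      Subtype.ext hz1
    rw [e1] at key
    exact key
  have hV₂' : ∀ ℓ m : ℕ, D.toSplitData.negSign.Kol ℓ → KolSupp D.toSplitData.negSign.Kol (ℓ * m) → ¬ ℓ ∣ m →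
      Odd (ℓ * m).primeFactors.card →
      ∀ (j N' a b : ℕ) (t₂ z₂ : (selmerGroup W (lvl (L + L)))), J₂ t₂ ∈ D.toSplitData.negSign.Sel →
      ((D.toSplitData.negSign.p : ℤ) ^ j) • D.toSplitData.negSign.c (ℓ * m) = J₂ z₂ →
      J₂ z₂ ∈ D.toSplitData.negSign.Sel → ((D.toSplitData.negSign.p : ℤ) ^ L) • J₂ t₂ = 0 →
      ((D.toSplitData.negSign.p : ℤ) ^ N') • J₂ t₂ = 0 →
      (∀ q ∈ m.primeFactors, J₂ t₂ ∈ D.toSplitData.negSign.A q) →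
      D.toSplitData.negSign.M - D.toSplitData.negSign.M₀ ≤ j → N' + D.toSplitData.negSign.M₀ ≤ D.toSplitData.negSign.M → N' ≤ j →
      a + b + 1 = N' →
      ((D.toSplitData.negSign.p : ℤ) ^ (a + (j - N'))) • D.toSplitData.negSign.c m ∉ D.toSplitData.negSign.A ℓ →
      ((D.toSplitData.negSign.p : ℤ) ^ b) • J₂ t₂ ∉ D.toSplitData.negSign.A ℓ →
      Q₂ z₂ t₂ ≠ 0 := by
    intro ℓ m hℓ hsupp hndvd hoddn j N' a b t₂ z₂ _ hzeq _ hk hN hAq hj hNM hNj hab hcm hbt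
    have hℓK : D.Kol ℓ := hℓ
    have hsuppK : KolSupp D.Kol (ℓ * m) := hsupp
    obtain ⟨-, hcard⟩ := D.kolSupp_of_mul hℓK hsuppK
    have hev : Even m.primeFactors.card := by
      rcases Nat.even_or_odd m.primeFactors.card with h | h
      · exact h
      · exfalso
        rw [← hcard] at hoddn
        exact (Nat.not_odd_iff_even.mpr h.add_one) hoddn
    rw [hpZ] at hzeq hk hN hcm hbt
    rw [hSdcO _ hoddn, hJ₂a, Prod.smul_mk, zsmul_zero] at hzeq
    have hz1 : ((2 : ℤ) ^ j) • D.c₂ (ℓ * m) = (z₂ : galH1Torsion W (lvl (L + L))) :=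
      congrArg Prod.snd hzeq
    have hz : ((2 : ℤ) ^ j) • D.c₂ (ℓ * m) ∈ selmerGroup W (lvl (L + L)) := by
      rw [hz1]; exact z₂.2
    rw [hJ₂a, Prod.smul_mk, zsmul_zero, Prod.mk_eq_zero] at hk hN
    have hAq' : ∀ q ∈ m.primeFactors, (t₂ : galH1Torsion W (lvl (L + L))) ∈ a₁ W (L + L) q :=
      fun q hq ↦ ((hAmem q _).mp (hAq q hq)).2
    rw [hM] at hj hNM
    have hcm' : ((2 : ℤ) ^ (a + (j - N'))) • D.c₁ m ∉ a₂ W K (L + L) ℓ := by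
      intro hmem
      apply hcm
      rw [hSdcE _ hev, Prod.smul_mk, zsmul_zero, hAmem]
      exact ⟨hmem, zero_mem _⟩
    have hbt' : ((2 : ℤ) ^ b) • (t₂ : galH1Torsion W (lvl (L + L))) ∉ a₁ W (L + L) ℓ := by
      intro hmem
      apply hbt
      rw [hJ₂a, Prod.smul_mk, zsmul_zero, hAmem]
      exact ⟨zero_mem _, hmem⟩
    have key := hV₂ ℓ m hℓK hsuppK hndvd hev j N' a b (t₂ : galH1Torsion W (lvl (L + L))) t₂.2
      hz hN.2 hk.2 hAq' hj hNM hNj hab hcm' hbt'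
    have e1 : (⟨((2 : ℤ) ^ j) • D.c₂ (ℓ * m), hz⟩ : ↥(selmerGroup W (lvl (L + L)))) = z₂ :=
      Subtype.ext hz1
    rw [e1] at key
    exact key
  have hCTV := hCTV_of_members_of_kill D.toSplitData.negSign J₁ J₂ hJ₁ hJ₂ hSelJ hpure₁ hpure₂ L P Q₁ Q₂ hPapply
    hV₁' hV₂'
  -- ### the remaining compatibilities and the telescope
  have heig := mem_toSplitData_negSign_eig_iff_mem_pairEig W K h2 hθ hd (L + L) hnoTors D f hf hf₁ hf₂
  have hKol : ∀ ℓ, D.toSplitData.negSign.Kol ℓ ↔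
      IsKolyvaginPrime N W K 2 ℓ ∧ FrobEqFrobInfty W K (2 ^ (L + L + 1)) ℓ ∧ S ℓ :=
    fun ℓ ↦ (D.toSplitData_kol_iff ℓ).trans (hDKol ℓ)
  have hA' : ∀ ℓ, D.toSplitData.negSign.Kol ℓ → ∀ v,
      v ∈ D.toSplitData.negSign.negSign.A ℓ ↔ f v ∈ pairA (N := N) W (sigmaQ K h2 hθ hd) (L + L) (-1) ℓ :=
    fun ℓ hℓ ↦ hA ℓ hℓ
  have hpA : ∀ a : ((twin W K).sha)[(2 ^ L : ℕ)], 2 ^ L • a = 0 := fun a ↦ AddSubgroup.torsionBy.nsmul a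
  have hJ₁ε : ∀ u : (selmerGroup (twin W K) (lvl (L + L))), (f (J₁ u)).2 = 0 := fun u ↦ snd_pairOfRatNeg_inl_eq_zero W K h2 hθ hd (L + L) f hf₂ u
  have hJ₂ε : ∀ v : (selmerGroup W (lvl (L + L))), (f (J₂ v)).1 = 0 := fun v ↦ fst_pairOfRatNeg_inr_eq_zero W K h2 hθ hd (L + L) f hf₁ v
  have hxSd : D.toSplitData.negSign.x = J₁ x₁ := by rw [toSplitData_negSign_x, hJ₁a, hx₁]
  have hP : ∀ (u u' : (selmerGroup (twin W K) (lvl (L + L)))) (v v' : (selmerGroup W (lvl (L + L)))), B₁ (ι₁ u) (ι₁ u') = 0 → Q₂ v v' = 0 →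
      P ⟨J₁ u + J₂ v, hSel u v⟩ ⟨J₁ u' + J₂ v', hSel u' v'⟩ = 0 := by
    intro u u' v v' h₁ h₂
    rw [hPapply, h₂, add_zero]
    exact h₁
  have hkM : L + D.toSplitData.negSign.M₀ ≤ D.toSplitData.negSign.M := by
    rw [hM]
    change L + D.M₀ ≤ L + L
    omega
  have hQ₂a : ∀ v w : (selmerGroup W (lvl (L + L))), Q₂ v w = B₂ (ι₂ v) (ι₂ w) := fun _ _ ↦ rfl
  have hQ₁a : ∀ u u' : (selmerGroup (twin W K) (lvl (L + L))), Q₁ u u' = B₁ (ι₁ u) (ι₁ u') := fun _ _ ↦ rfl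
  have hBalt : ∀ v : (selmerGroup W (lvl (L + L))), Q₂ v v = 0 := fun v ↦ by
    rw [hQ₂a]; exact hB₂alt v
  have hBnd : ∀ v : (selmerGroup W (lvl (L + L))), (∀ w, Q₂ v w = 0) → v = 0 := fun v hv ↦
    hB₂nd v fun w ↦ by rw [← hQ₂a]; exact hv w
  exact card_mul_card_le_two_pow_two_mul_of_injective_of_kill W (sigmaQ K h2 hθ hd) (L + L) hC hK hρ hΔ
    hΔK (sigmaQ_ne_one K h2 hθ hd) hc₀ hzfix hcomm hS hP₀ (Or.inr rfl) f hf D.toSplitData.negSign hp heig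
    ((pairDelta W (sigmaQ K h2 hθ hd) (L + L) (-1)).comap f) (fun _ ↦ AddSubgroup.mem_comap) hA' hKol
    (PairDataM.toSplitData_negSign_ε D) L P hCTV ι₁ hι₁ x₁ hker hxord B₁ hB₁alt hB₁nd Q₂ hBalt hBnd hpA hkill₂
    J₁ J₂ hJ₁ hJ₂ hJ₁ε hJ₂ε hxSd hSel hP hkM

end Summit.BirchSwinnertonDyer.BirchSwinnertonDyer.Theorems.KolyvaginPairDataTwo

end
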